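import Literature.MathematicalPhysics.QuantumFieldTheory.Balaban1983to89.T4OutputRate

/-!
# NE9ComplexEncoding — the ℝ-valued NE9 frame carries COMPLEX-valued term families on COMPLEX background domains: pull-back of
`NE9` along carrier maps and the Re/Im doubling of the domain index (skeleton `t4/b2b-balaban-t4-ne9-p1/SKELETON-NE9-P1.md` v1.3
§4 O-NE9-1 TYPING NOTE, census E38; cell `pub-balaban`, T4-DAG §2 node U3 / §6 NE9; lineage t4-ne9-p1 = prover P1, generation 22)

HONEST FRAMING (T4-DAG PAGE 1).  Rung (B)+1 on a FIXED finite torus with `FlowStep.BetaPertH` and (B) explicit — NOT infinite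
volume, NOT a mass gap, NOT the Clay problem.  NE9 is a cell NEW ESTIMATE, NOT PRINTED, NOT discharged here: bookkeeping over the
ABSTRACT carriers of `T4OutputRate`; nothing of [I] = [Balaban1987RG1] is modelled; quotations for TYPES/STRUCTURE only.  0/9 unchanged.

WHY.  `T4OutputRate.Functional C Bg := (ℕ → ℝ) → Bg → C.Dom → ℝ` is REAL-valued over an ABSTRACT background type, and
`T4OutputRate.NE9 E W κ Λ` bounds `|E g U X − E g′ U X|`.  Bałaban's terms are complex analytic on the COMPLEX small-field spaces:
[I] p. 263 *"We assume that the function 𝐄^{(j)}(X, g_{j−1}, U, J) is defined and analytic on the space U^c_j(X, α₀, α₁)"*, and the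
channel bound of [II] Lemma 1 for the next step is obtained by CAUCHY ESTIMATES in the background ((1.23)–(1.24) p. 7: *"we
represent all derivatives by the Cauchy formula"*), so a history recursion must control the DIFFERENCE of two histories' terms on the
complex domain, real AND imaginary part.  The frame accommodates this without any change: take `Bg` := the complex space and DOUBLE
the domain index — one copy carries `Re 𝐄`, the other `Im 𝐄`, same creation step, same tree length.  This module records the
two directions of that dictionary: (i) `NE9` pulls back along maps of carriers and backgrounds (so the consumer's real-background
statement is the restriction of the complex-domain one), (ii) `NE9` for the doubled real family gives the complex modulus bound with
the factor 2 and the real-part/imaginary-part families separately.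

WHAT IS PROVED (kernel, `[folklore]` bookkeeping): `ne9_comap` (pull-back of NE9 along a scale- and d-preserving map of domains and
any map of backgrounds), `doubleCarriers`, `reIm`, `ne9_re_of_reIm` / `ne9_im_of_reIm` (the two real families), `norm_sub_le_of_ne9_reIm`
(complex modulus ≤ 2 × the NE9 right-hand side), `ne9_reIm_of_parts` (conversely, NE9 for both parts with a common Λ gives NE9 for
the doubled family).

References (TYPES only): [Balaban1987RG1] CMP 109 (1987) p. 263 (1.18) and the analyticity sentence; [Balaban1988RG2Cluster]
CMP 116 (1988) (1.23)–(1.24) p. 7.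
-/

noncomputable section

namespace Summit.QuantumFields.BalabanUV.T4Continuum.NE9ComplexEncoding

open scoped BigOperators
open Literature.MathematicalPhysics.QuantumFieldTheory.Balaban1983to89
open Literature.MathematicalPhysics.QuantumFieldTheory.Balaban1983to89.T4OutputRate

variable {C C' : Carriers} {Bg Bg' : Type}

/-! ## §1 Pull-back of NE9 along carrier maps -/

/-- **NE9 PULLS BACK**: if `E′` satisfies NE9 on carriers `C′` / backgrounds `Bg′` and `E g U X = E′ g (φ U) (f X)` for a map of
domains `f` preserving creation step and tree length and any map of backgrounds `φ`, then `E` satisfies NE9 with the same κ, Λ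
(the consumer's real-background NE9 from a complex-domain instance: `φ` = the inclusion of real configurations).
[cite: Balaban1987RG1, §1 p.263] -/
theorem ne9_comap {E : Functional C Bg} {E' : Functional C' Bg'} {W : Set (ℕ → ℝ)} {κ : ℝ} {Λ : ℕ → ℕ → ℝ}
    (f : C.Dom → C'.Dom) (φ : Bg → Bg') (hscale : ∀ X, C'.scale (f X) = C.scale X) (hd : ∀ X, C'.d (f X) = C.d X)
    (hE : ∀ g (U : Bg) (X : C.Dom), E g U X = E' g (φ U) (f X)) (h : NE9 E' W κ Λ) : NE9 E W κ Λ := by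
  intro g hg g' hg' U X
  have h1 := h g hg g' hg' (φ U) (f X)
  rw [hscale X, hd X] at h1
  rwa [hE g U X, hE g' U X]

/-! ## §2 The Re/Im doubling of the domain index -/

/-- The DOUBLED carriers: every localization domain in two copies (tag `true` ↦ real part, `false` ↦ imaginary part), same
creation step, same tree length, same backgrounds. [cite: Balaban1987RG1, (0.24)-(0.25) p.257] -/
def doubleCarriers (C : Carriers) : Carriers where
  Dom := C.Dom × Bool
  scale := fun X => C.scale X.1
  d := fun X => C.d X.1
  d_nonneg := fun X => C.d_nonneg X.1
  BgA := C.BgA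
  BgB := C.BgB
  gauge := C.gauge
  gauge_nonneg := C.gauge_nonneg
  transport := C.transport

/-- The doubled REAL family of a complex-valued term family: real part on the `true` copy, imaginary part on the `false` copy.
[cite: Balaban1987RG1, §1 p.263] -/
def reIm (F : (ℕ → ℝ) → Bg → C.Dom → ℂ) : Functional (doubleCarriers C) Bg :=
  fun g U X => if X.2 then (F g U X.1).re else (F g U X.1).im

/-- On the `true` copy the doubled family is the real part. [folklore] -/
theorem reIm_true (F : (ℕ → ℝ) → Bg → C.Dom → ℂ) (g : ℕ → ℝ) (U : Bg) (X : C.Dom) :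
    reIm F g U (X, true) = (F g U X).re := rfl

/-- On the `false` copy the doubled family is the imaginary part. [folklore] -/
theorem reIm_false (F : (ℕ → ℝ) → Bg → C.Dom → ℂ) (g : ℕ → ℝ) (U : Bg) (X : C.Dom) :
    reIm F g U (X, false) = (F g U X).im := rfl

/-- NE9 for the doubled family gives NE9 for the REAL-PART family on the original carriers (pull-back along `X ↦ (X, true)`).
[folklore] -/
theorem ne9_re_of_reIm {F : (ℕ → ℝ) → Bg → C.Dom → ℂ} {W : Set (ℕ → ℝ)} {κ : ℝ} {Λ : ℕ → ℕ → ℝ}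
    (h : NE9 (reIm F) W κ Λ) : NE9 (C := C) (fun g U X => (F g U X).re) W κ Λ :=
  ne9_comap (C' := doubleCarriers C) (fun X => (X, true)) id (fun _ => rfl) (fun _ => rfl) (fun _ _ _ => rfl) h

/-- NE9 for the doubled family gives NE9 for the IMAGINARY-PART family on the original carriers. [folklore] -/
theorem ne9_im_of_reIm {F : (ℕ → ℝ) → Bg → C.Dom → ℂ} {W : Set (ℕ → ℝ)} {κ : ℝ} {Λ : ℕ → ℕ → ℝ}
    (h : NE9 (reIm F) W κ Λ) : NE9 (C := C) (fun g U X => (F g U X).im) W κ Λ :=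
  ne9_comap (C' := doubleCarriers C) (fun X => (X, false)) id (fun _ => rfl) (fun _ => rfl) (fun _ _ _ => rfl) h

/-- **THE COMPLEX MODULUS BOUND**: NE9 for the doubled real family bounds the complex difference of the two histories' terms by
TWICE the NE9 right-hand side (`‖z‖ ≤ |Re z| + |Im z|`). [folklore] -/
theorem norm_sub_le_of_ne9_reIm {F : (ℕ → ℝ) → Bg → C.Dom → ℂ} {W : Set (ℕ → ℝ)} {κ : ℝ} {Λ : ℕ → ℕ → ℝ}
    (h : NE9 (reIm F) W κ Λ) :
    ∀ g ∈ W, ∀ g' ∈ W, ∀ (U : Bg) (X : C.Dom),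
      ‖F g U X - F g' U X‖ ≤
        2 * (Real.exp (-(κ * C.d X)) * ∑ i ∈ Finset.range (C.scale X), Λ (C.scale X) i * |g i - g' i|) := by
  intro g hg g' hg' U X
  have hre := ne9_re_of_reIm h g hg g' hg' U X
  have him := ne9_im_of_reIm h g hg g' hg' U X
  simp only at hre him
  rw [← Complex.sub_re] at hre
  rw [← Complex.sub_im] at him
  calc ‖F g U X - F g' U X‖ ≤ |(F g U X - F g' U X).re| + |(F g U X - F g' U X).im| := Complex.norm_le_abs_re_add_abs_im _
    _ ≤ _ := by linarith

/-- **CONVERSELY**: NE9 for the real-part family and for the imaginary-part family with a COMMON Λ give NE9 for the doubled family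
(so a recursion may be run on the doubled family and read back part by part). [folklore] -/
theorem ne9_reIm_of_parts {F : (ℕ → ℝ) → Bg → C.Dom → ℂ} {W : Set (ℕ → ℝ)} {κ : ℝ} {Λ : ℕ → ℕ → ℝ}
    (hre : NE9 (C := C) (fun g U X => (F g U X).re) W κ Λ) (him : NE9 (C := C) (fun g U X => (F g U X).im) W κ Λ) :
    NE9 (reIm F) W κ Λ := by
  intro g hg g' hg' U X
  rcases X with ⟨X, b⟩
  cases b
  · simpa [reIm, doubleCarriers] using him g hg g' hg' U X
  · simpa [reIm, doubleCarriers] using hre g hg g' hg' U X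

/-- NON-VACUITY / SANITY: for a history-independent complex family the doubled family satisfies NE9 with Λ ≡ 0. [folklore] -/
theorem ne9_reIm_of_const (F₀ : Bg → C.Dom → ℂ) (W : Set (ℕ → ℝ)) (κ : ℝ) :
    NE9 (reIm (C := C) fun _ => F₀) W κ (fun _ _ => 0) := by
  intro g _ g' _ U X
  simp [reIm]

end Summit.QuantumFields.BalabanUV.T4Continuum.NE9ComplexEncoding

end
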